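import Mathlib.NumberTheory.NumberField.Discriminant.Defs
import Mathlib.RingTheory.Artinian.Module
import Mathlib.RingTheory.Trace.Basic
import Mathlib.RingTheory.TensorProduct.Free
import Mathlib.LinearAlgebra.Trace
import Mathlib.LinearAlgebra.Eigenspace.Zero
import Mathlib.LinearAlgebra.Matrix.Nondegenerate
import Mathlib.Algebra.CharP.Defs
import HarnessLib

/-!
# At a prime `p ∤ d(K)` the ring of integers acts SEMISIMPLY modulo `p`: a nilpotent `𝓞_K`-operator on a
# vector space of characteristic `p` is zero (Dedekind's discriminant theorem, operator form)

Topic `Literature/NumberTheory/NumberFields`, namespace `Literature.NumberTheory.NumberFields`.  THEOREMS ONLY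
(no definition, no named fact, no instance; net Literature debt 0); Mathlib-only imports.

THE MATHEMATICS.  Let `K` be a number field and `κ` a field of characteristic `p` with `p ∤ d(K)`
(`NumberField.discr`; throughout, `p : ℕ` with `[CharP κ p]` — no primality hypothesis is needed, `p = 0` being allowed).  Then the finite commutative `κ`-algebra `E := κ ⊗_ℤ 𝓞_K` is REDUCED: the trace form of `E/κ`
in the basis `1 ⊗ bᵢ` (`bᵢ` an integral basis) has Gram matrix `(Tr_{𝓞_K/ℤ}(bᵢbⱼ) mod p)`, whose determinant is
`d(K) mod p ≠ 0`; a nilpotent `x ∈ E` has `Tr(x·y) = 0` for every `y` (nilpotent operators have trace zero), so its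
coordinate vector is killed by a non-degenerate matrix, i.e. `x = 0` — this is the easy half of Dedekind's theorem
«`p` ramifies in `K` iff `p ∣ d(K)`» ([Neukirch1999] Ch. III Thm. (2.9), Cor. (2.12); [Marcus1977] Ch. 3 Thm. 24 / Ch. 4),
read as «`𝓞_K/p𝓞_K` is a separable (étale) `𝔽_p`-algebra».  A reduced Artinian commutative ring is a finite product
of fields, hence VON NEUMANN REGULAR: every `e` is `e = x·e²` (here from Mathlib's `IsArtinian.exists_pow_succ_smul_dvd`).
CONSEQUENCE (the headline, `RingOfIntegers.eq_zero_of_isNilpotent_of_not_dvd_discr`): for ANY ring homomorphism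
`ρ : 𝓞_K → E′` into a `κ`-algebra `E′` (e.g. `E′ = End_κ(V)`), if `ρ(α)` is nilpotent then `ρ(α) = 0` — `ρ ⊗ κ`
factors through `E`, and `e = xⁿeⁿ⁺¹ ↦ 0`.  In characteristic-polynomial form: `char(ρ(α) | V) = X^{dim V} ⇒ ρ(α) = 0`.

WHY (cell `hodgecm-mathlib`, D-0151, fan B-II, E2 «height-one road» for [Shimura1998] §13.1 Thm. 1 (i) at `N𝔭 = p`,
`p ∤ d(K)` = row II-1-S2₁′ `shimuraTaniyamaPair_degOne'`; A-p02's memo `ROAD-E2-heightOne-S2degOne.md` §1 S3 / §0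
FINDING E1′).  In the reduction `Ã` of a CM abelian variety `(A, ι)` of type `(K, Φ)` modulo a prime `𝔓 ∣ 𝔭` of good
reduction, the characteristic polynomial of `ι̃(α)` on the cotangent space `𝔪_e/𝔪_e²(Ã)` is the reduction of
`∏_{φ ∈ Φ} (X − φ(α))`, which is `X^g` when `α` lies in the reflex norm `g(𝔭)` ([Shimura1998] §13.1–13.2, p. 129 of
§18.6): so `ι̃(α)` is NILPOTENT on the cotangent space, and the present file turns «nilpotent» into «zero» exactly under
Shimura's §13.2 proviso `p ∤ d(K)` (there: «`det [β^φ | β^{ρφ}]² = d(K)` is a `𝔓₁`-unit», pp. 130–131) — with no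
eigen-decomposition of the cotangent lattice and no extension of the residue field.  HC_CM is proved only modulo the
7 printed citations until rung 0 closes; this file is a banked generic leaf and changes no count.

WHAT IS PROVED.
* §1 (pure algebra; private helpers `eq_pow_mul_pow_succ_of_eq_mul_sq`, `map_eq_zero_of_isNilpotent_of_eq_mul_sq`:
  a ring map that sends an element `e = x·e²` to a nilpotent sends it to `0`) `exists_eq_mul_sq_of_isReduced` (reduced
  Artinian commutative rings are von Neumann regular, [AtiyahMacdonald1969] Ch. 3 Ex. 11 / Ch. 8).
* §2 (private `RingOfIntegers.trace_one_tmul`: `Tr_{E/κ}(1 ⊗ z) = Tr_{𝓞_K/ℤ}(z) mod p`)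
  `RingOfIntegers.isReduced_tensorProduct_of_not_dvd_discr` (`κ ⊗_ℤ 𝓞_K` is reduced for `p ∤ d(K)`),
  `RingOfIntegers.exists_eq_mul_sq_of_not_dvd_discr`.
* §3 `RingOfIntegers.eq_zero_of_isNilpotent_of_not_dvd_discr` (HEADLINE) and
  `RingOfIntegers.eq_zero_of_charpoly_eq_X_pow_of_not_dvd_discr` (`End_κ(V)` / characteristic-polynomial form).

## References
* [AtiyahMacdonald1969] M. F. Atiyah, I. G. Macdonald, *Introduction to Commutative Algebra* (1969), Ch. 2 Ex. 27–28,
  Ch. 3 Ex. 11 (absolutely flat = reduced of dimension 0), Ch. 8 Thm. 8.7 (structure of Artin rings).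
* [Neukirch1999] J. Neukirch, *Algebraic Number Theory* (1999), Ch. I §2 (discriminant = det of the trace form),
  Ch. III Thm. (2.9) and Cor. (2.12) (Dedekind: `p` is unramified iff `p ∤ d`).
* [Marcus1977] D. A. Marcus, *Number Fields* (1977), Ch. 3 Thm. 24, Ch. 4 (ramification and the discriminant).
* [Shimura1998] G. Shimura, *Abelian Varieties with Complex Multiplication and Modular Functions* (1998), §13.1 Thm. 1,
  §13.2 (pp. 130–131), §18.6 (p. 129).
-/

set_option autoImplicit false

noncomputable section

open scoped TensorProduct NumberField
open Polynomial Module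

namespace Literature.NumberTheory.NumberFields

/-! ## §1 Pure algebra: elements `e = x·e²` with nilpotent image vanish; reduced Artinian rings -/

section Algebra

variable {E : Type*} [CommRing E]

/-- In a commutative ring, `e = x·e²` propagates to `e = xⁿ·eⁿ⁺¹` for every `n`. [folklore] -/
private theorem eq_pow_mul_pow_succ_of_eq_mul_sq {e x : E} (h : e = x * e ^ 2) (n : ℕ) :
    e = x ^ n * e ^ (n + 1) := by
  induction n with
  | zero => simp
  | succ n ih =>
    calc e = x ^ n * e ^ (n + 1) := ih
      _ = x ^ n * e ^ n * e := by ring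
      _ = x ^ n * e ^ n * (x * e ^ 2) := by rw [← h]
      _ = x ^ (n + 1) * e ^ (n + 1 + 1) := by ring

/-- **A ring map sending a von-Neumann-regular element to a nilpotent sends it to zero**: if `e = x·e²` in a
commutative ring `E` and `g : E → E′` is a ring homomorphism (any semiring `E′`) with `g(e)` nilpotent, then
`g(e) = 0` — indeed `g(e) = g(x)ⁿ·g(e)ⁿ·g(e)`. [folklore] -/
private theorem map_eq_zero_of_isNilpotent_of_eq_mul_sq {E' : Type*} [Semiring E'] (g : E →+* E') {e x : E}
    (h : e = x * e ^ 2) (hn : IsNilpotent (g e)) : g e = 0 := by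
  obtain ⟨n, hn⟩ := hn
  rw [eq_pow_mul_pow_succ_of_eq_mul_sq h n, map_mul, map_pow, map_pow, pow_succ, hn, zero_mul, mul_zero]

/-- **A reduced Artinian commutative ring is von Neumann regular**: every `e` satisfies `e = y·e²` for some `y`.
(The chain `(eⁿ)` stabilises, `eⁿ⁺¹y = eⁿ` (Mathlib `IsArtinian.exists_pow_succ_smul_dvd`); then `e(1 − ye)` is
nilpotent — its `(n+1)`-st power contains `eⁿ(1 − ye) = 0` — hence zero.)  Equivalently: `E` is a finite product
of fields (Atiyah–Macdonald: a ring is absolutely flat iff reduced with every prime maximal; structure theorem for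
Artin rings). [cite: AtiyahMacdonald1969, Ch. 3 Exercise 11 with Ch. 2 Exercises 27–28; Ch. 8 Thm. 8.7] -/
theorem exists_eq_mul_sq_of_isReduced [IsArtinianRing E] [IsReduced E] (e : E) : ∃ y : E, e = y * e ^ 2 := by
  obtain ⟨n, y, hy⟩ := IsArtinian.exists_pow_succ_smul_dvd e (1 : E)
  simp only [smul_eq_mul, mul_one] at hy
  refine ⟨y, ?_⟩
  have h2 : e ^ n * (1 - y * e) = 0 := by
    have : e ^ n * (1 - y * e) = e ^ n - e ^ n.succ * y := by rw [Nat.succ_eq_add_one]; ring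
    rw [this, hy, sub_self]
  have h3 : IsNilpotent (e - y * e ^ 2) := ⟨n + 1, by
    rw [show e - y * e ^ 2 = e * (1 - y * e) by ring, mul_pow]
    calc e ^ (n + 1) * (1 - y * e) ^ (n + 1) = e * (e ^ n * (1 - y * e)) * (1 - y * e) ^ n := by ring
      _ = 0 := by rw [h2, mul_zero, zero_mul]⟩
  exact sub_eq_zero.mp h3.eq_zero

end Algebra

/-! ## §2 `κ ⊗_ℤ 𝓞_K` is reduced when `char κ = p ∤ d(K)` (trace form / discriminant) -/

section Discriminant

variable (K : Type*) [Field K] [NumberField K] (κ : Type*) [Field κ]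

/-- **The trace of `1 ⊗ z` on `κ ⊗_ℤ 𝓞_K` is `Tr_{𝓞_K/ℤ}(z)` read in `κ`** (trace commutes with base change: left
multiplication by `1 ⊗ z` is the base change of left multiplication by `z`, Mathlib `Algebra.baseChange_lmul` +
`LinearMap.trace_baseChange`). [folklore] -/
private theorem RingOfIntegers.trace_one_tmul (z : 𝓞 K) :
    Algebra.trace κ (κ ⊗[ℤ] 𝓞 K) ((1 : κ) ⊗ₜ[ℤ] z) = algebraMap ℤ κ (Algebra.trace ℤ (𝓞 K) z) := by
  rw [Algebra.trace_apply, Algebra.trace_apply, ← Algebra.baseChange_lmul, LinearMap.trace_baseChange]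

variable (p : ℕ) [CharP κ p]

/-- **`κ ⊗_ℤ 𝓞_K` is reduced for a field `κ` of characteristic `p ∤ d(K)`** (Dedekind's discriminant theorem in the
form «`𝓞_K ⊗ κ` is étale»): in the `κ`-basis `1 ⊗ bᵢ` (`bᵢ` = `RingOfIntegers.basis K`) the trace form of
`κ ⊗_ℤ 𝓞_K` has Gram matrix `Tr(bᵢbⱼ) mod p` with determinant `d(K) mod p ≠ 0`; a nilpotent `x` has `Tr(x·(1 ⊗ bⱼ)) = 0`
for all `j` (nilpotent elements have nilpotent, hence zero, trace: Mathlib `Algebra.isNilpotent_trace_of_isNilpotent`),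
so its coordinate vector `c` satisfies `c ᵥ* (Tr(bᵢbⱼ) mod p) = 0`, whence `c = 0` (`Matrix.eq_zero_of_vecMul_eq_zero`).
[cite: Neukirch1999, Ch. III Thm. (2.9) and Cor. (2.12); Ch. I §2 (discriminant as det of the trace form)] -/
theorem RingOfIntegers.isReduced_tensorProduct_of_not_dvd_discr (hdisc : ¬ ((p : ℤ) ∣ NumberField.discr K)) :
    IsReduced (κ ⊗[ℤ] 𝓞 K) := by
  classical
  set b := NumberField.RingOfIntegers.basis K with hb
  set bE := Algebra.TensorProduct.basis κ b with hbE
  -- the reduced Gram matrix of the trace form and its determinant `d(K) mod p ≠ 0`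
  set M : Matrix (Free.ChooseBasisIndex ℤ (𝓞 K)) (Free.ChooseBasisIndex ℤ (𝓞 K)) κ :=
    (Int.castRingHom κ).mapMatrix (Algebra.traceMatrix ℤ b) with hM
  have hdet : M.det ≠ 0 := by
    rw [hM, ← RingHom.map_det, ← Algebra.discr_def, eq_intCast, Ne, CharP.intCast_eq_zero_iff κ p]
    exact hdisc
  -- the entries of `M` are the traces `Tr((1 ⊗ bᵢ)(1 ⊗ bⱼ))`
  have hentry : ∀ i j, M i j = Algebra.trace κ (κ ⊗[ℤ] 𝓞 K) (bE i * bE j) := fun i j => by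
    rw [hM, RingHom.mapMatrix_apply, Matrix.map_apply, Algebra.traceMatrix_apply, Algebra.traceForm_apply, hbE,
      Algebra.TensorProduct.basis_apply, Algebra.TensorProduct.basis_apply, Algebra.TensorProduct.tmul_mul_tmul,
      one_mul, RingOfIntegers.trace_one_tmul, eq_intCast, eq_intCast]
  refine ⟨fun x hx => ?_⟩
  -- `Tr(x · (1 ⊗ b j)) = 0`, expanded in coordinates
  have htr : ∀ j, ∑ i, bE.repr x i * M i j = 0 := fun j => by
    have hnil : IsNilpotent (x * bE j) := Commute.isNilpotent_mul_right (Commute.all _ _) hx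
    have h0 : Algebra.trace κ (κ ⊗[ℤ] 𝓞 K) (x * bE j) = 0 :=
      (Algebra.isNilpotent_trace_of_isNilpotent hnil).eq_zero
    rw [← h0]
    conv_rhs => rw [← bE.sum_repr x]
    rw [Finset.sum_mul, map_sum]
    refine Finset.sum_congr rfl fun i _ => ?_
    rw [smul_mul_assoc, map_smul, smul_eq_mul, hentry]
  have hc : Matrix.vecMul (bE.repr x) M = 0 :=
    funext fun j => by rw [Matrix.vecMul, dotProduct]; exact htr j
  have hc0 : bE.repr x = 0 := Finsupp.coe_eq_zero.mp (Matrix.eq_zero_of_vecMul_eq_zero hdet hc)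
  exact bE.repr.map_eq_zero_iff.mp hc0

/-- **`κ ⊗_ℤ 𝓞_K` is von Neumann regular for `char κ = p ∤ d(K)`**: every `e` is `e = y·e²` (reduced by
`isReduced_tensorProduct_of_not_dvd_discr`, Artinian as a finite-dimensional `κ`-algebra). Equivalently `κ ⊗_ℤ 𝓞_K`
is a finite product of fields (`𝓞_K/p𝓞_K` is a separable `𝔽_p`-algebra).
[cite: Neukirch1999, Ch. III Thm. (2.9) and Cor. (2.12)] -/
theorem RingOfIntegers.exists_eq_mul_sq_of_not_dvd_discr (hdisc : ¬ ((p : ℤ) ∣ NumberField.discr K))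
    (e : κ ⊗[ℤ] 𝓞 K) : ∃ y : κ ⊗[ℤ] 𝓞 K, e = y * e ^ 2 := by
  haveI := RingOfIntegers.isReduced_tensorProduct_of_not_dvd_discr K κ p hdisc
  haveI : IsArtinianRing (κ ⊗[ℤ] 𝓞 K) := IsArtinianRing.of_finite κ _
  exact exists_eq_mul_sq_of_isReduced e

end Discriminant

/-! ## §3 HEADLINE: a nilpotent `𝓞_K`-operator in characteristic `p ∤ d(K)` is zero -/

section Headline

variable (K : Type*) [Field K] [NumberField K] (κ : Type*) [Field κ] (p : ℕ) [CharP κ p]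

/-- **A nilpotent `𝓞_K`-operator in characteristic `p ∤ d(K)` is zero.**  Let `κ` be a field of characteristic `p`
with `p ∤ d(K)` and `ρ : 𝓞_K → E′` a ring homomorphism into a `κ`-algebra `E′` (not necessarily commutative — e.g.
`E′ = End_κ(V)`, or the endomorphisms of the cotangent space of the reduction of a CM abelian variety).  If `ρ(α)` is
nilpotent then `ρ(α) = 0`.  Proof: `ρ` and `κ → E′` assemble to `g : κ ⊗_ℤ 𝓞_K → E′` (the structure map is central),
`e := 1 ⊗ α` satisfies `e = y·e²` (`exists_eq_mul_sq_of_not_dvd_discr`), and `g(e) = ρ(α)` is nilpotent, hence `0`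
(`map_eq_zero_of_isNilpotent_of_eq_mul_sq`).  This is the operator form of Dedekind's theorem «`p ∤ d(K)` ⇒
`𝓞_K/p𝓞_K` is a product of (separable) fields»: `𝓞_K`-modules in characteristic `p` are then sums of eigenspaces,
on which a nilpotent scalar must vanish — used in [Shimura1998] §13.2 (pp. 130–131, the proviso that
`det [β^φ | β^{ρφ}]² = d(K)` be a `𝔓₁`-unit) to pass from «`δι̃(α)` has characteristic polynomial `X^g`» to
«`δι̃(α) = 0`».
[cite: Neukirch1999, Ch. III Thm. (2.9) and Cor. (2.12)] [cite: Shimura1998, §13.2 (pp. 130–131)] -/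
theorem RingOfIntegers.eq_zero_of_isNilpotent_of_not_dvd_discr (hdisc : ¬ ((p : ℤ) ∣ NumberField.discr K))
    {E' : Type*} [Ring E'] [Algebra κ E'] (ρ : 𝓞 K →+* E') {α : 𝓞 K} (hα : IsNilpotent (ρ α)) :
    ρ α = 0 := by
  let g : κ ⊗[ℤ] 𝓞 K →ₐ[ℤ] E' :=
    Algebra.TensorProduct.lift (algebraMap κ E').toIntAlgHom ρ.toIntAlgHom
      fun x y => Algebra.commute_algebraMap_left x (ρ y)
  have hg : g ((1 : κ) ⊗ₜ[ℤ] α) = ρ α := by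
    change Algebra.TensorProduct.lift _ _ _ ((1 : κ) ⊗ₜ[ℤ] α) = ρ α
    rw [Algebra.TensorProduct.lift_tmul]
    simp
  obtain ⟨y, hy⟩ := RingOfIntegers.exists_eq_mul_sq_of_not_dvd_discr K κ p hdisc ((1 : κ) ⊗ₜ[ℤ] α)
  have h := map_eq_zero_of_isNilpotent_of_eq_mul_sq (g : κ ⊗[ℤ] 𝓞 K →+* E') hy
    (by rw [RingHom.coe_coe, hg]; exact hα)
  rwa [RingHom.coe_coe, hg] at h

/-- **Characteristic-polynomial form**: for a finite-dimensional `κ`-vector space `V` (`char κ = p ∤ d(K)`) and a ring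
homomorphism `ρ : 𝓞_K → End_κ(V)`, if the characteristic polynomial of `ρ(α)` is `X^{dim V}` then `ρ(α) = 0`
(`char = X^{dim}` ⇔ nilpotent, Mathlib `LinearMap.isNilpotent_iff_charpoly`; then the headline).  This is the shape
consumed on the cotangent space of the reduction of a CM abelian variety: `char(ι̃(α) | 𝔪_e/𝔪_e²(Ã)) =
(∏_{φ∈Φ}(X − φ(α))) mod 𝔓 = X^g` for `α ∈ g(𝔭)` ⇒ `ι̃(α)^* = 0`.
[cite: Shimura1998, §13.2 (pp. 130–131) with §13.1 Thm. 1] [cite: Neukirch1999, Ch. III Cor. (2.12)] -/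
theorem RingOfIntegers.eq_zero_of_charpoly_eq_X_pow_of_not_dvd_discr (hdisc : ¬ ((p : ℤ) ∣ NumberField.discr K))
    (V : Type*) [AddCommGroup V] [Module κ V] [FiniteDimensional κ V] (ρ : 𝓞 K →+* Module.End κ V) (α : 𝓞 K)
    (h : (ρ α).charpoly = X ^ Module.finrank κ V) : ρ α = 0 :=
  RingOfIntegers.eq_zero_of_isNilpotent_of_not_dvd_discr K κ p hdisc ρ
    ((LinearMap.isNilpotent_iff_charpoly (ρ α)).mpr h)

end Headline

end Literature.NumberTheory.NumberFields

end
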